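import Mathlib.NumberTheory.ModularForms.SlashActions
import Mathlib.NumberTheory.ModularForms.CongruenceSubgroups
import Mathlib.Analysis.Complex.Periodic
import Mathlib.Analysis.Complex.UpperHalfPlane.FunctionsBoundedAtInfty

/-!
# Route CapacityClassicality — auxiliary vocabulary for the glue `CongruenceToClassical`

Auxiliary (non-mathematical) vocabulary used by the prover files
`CapacityClassicalityCongruenceToClassical*.lean` (item stmt-Langlands-10367, the glue
`IntegralOverconvergentIsCongruence → EigenIntegralOverconvergentIsClassical`), whose content is
the classical "cusp-pole removal" argument: a weight-`k` form `G = F / Δ ^ m` on `Γ₁(M)` that is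
holomorphic on `ℍ` and at `i∞` and satisfies the `T_ℓ`-functional equation
`∑_{j<ℓ} G ∣ [[1,j],[0,ℓ]] + ψ(ℓ) G ∣ [[ℓ,0],[0,1]] = a_ℓ G + const` is bounded at every cusp.

* `Egr c τ = exp (2π c · Im τ)` — growth comparison functions on `ℍ`;
* `axisPath y = i · max(y, 1)` — the imaginary axis, along which polynomial factors
  `(cτ + d)^(-k)` are harmless for every sign of `k`;
* `glOfInt μ` — an integer `2 × 2` matrix viewed in `GL(2, ℝ)` (junk value `1` if `det μ = 0`);
* `matU ℓ j = [[1, j], [0, ℓ]]`, `matV ℓ = [[ℓ, 0], [0, 1]]` and their images `βU ℓ j`, `βV ℓ` in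
  `GL(2, ℝ)` — the `ℓ + 1` matrices of the Hecke correspondence at a prime `ℓ`;
together with their `simp` API (entries, determinants, Möbius action, slash action).
[folklore]
-/

set_option linter.dupNamespace false -- project-wide option (lakefile weak.linter.dupNamespace); `Summit.Langlands.Langlands` is the mandated namespace

noncomputable section

open Complex UpperHalfPlane Matrix Filter

open scoped MatrixGroups ModularForm Real

namespace Summit.Langlands.Langlands.Theorems.CapacityClassicality

local notation "𝕢" => Function.Periodic.qParam

/-! ## Growth comparison functions -/

/-- Exponential growth comparison function `Egr c τ = exp (2π c · Im τ)`. -/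
def Egr (c : ℝ) (τ : ℍ) : ℝ := Real.exp (2 * π * c * τ.im)

/-- `Egr c τ` unfolds to `exp (2π c · Im τ)`. -/
lemma Egr_apply (c : ℝ) (τ : ℍ) : Egr c τ = Real.exp (2 * π * c * τ.im) := rfl

/-- `Egr c τ` is positive. -/
lemma Egr_pos (c : ℝ) (τ : ℍ) : 0 < Egr c τ := Real.exp_pos _

/-- Additivity of `Egr` in the exponent. -/
lemma Egr_add (a b : ℝ) (τ : ℍ) : Egr (a + b) τ = Egr a τ * Egr b τ := by
  simp only [Egr, ← Real.exp_add]
  ring_nf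

/-- `Egr 0 = 1`. -/
@[simp] lemma Egr_zero (τ : ℍ) : Egr 0 τ = 1 := by simp [Egr]

/-- Monotonicity of `Egr` in the exponent. -/
lemma Egr_mono {a b : ℝ} (h : a ≤ b) (τ : ℍ) : Egr a τ ≤ Egr b τ := by
  unfold Egr
  have := τ.im_pos
  gcongr

/-- The norm of `Egr` is itself. -/
@[simp] lemma norm_Egr (c : ℝ) (τ : ℍ) : ‖Egr c τ‖ = Egr c τ :=
  Real.norm_of_nonneg (Egr_pos c τ).le

/-- The norm of the `q`-parameter in terms of `Egr`. -/
lemma norm_qParam_eq_Egr (h : ℝ) (τ : ℍ) : ‖𝕢 h τ‖ = Egr (-(1 / h)) τ := by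
  rw [Function.Periodic.norm_qParam, Egr, UpperHalfPlane.coe_im]
  congr 1
  ring

/-- The norm of a power of the `q`-parameter in terms of `Egr`. -/
lemma norm_qParam_pow_eq_Egr (h : ℝ) (τ : ℍ) (n : ℕ) :
    ‖𝕢 h τ ^ n‖ = Egr (-(n / h)) τ := by
  rw [norm_pow, norm_qParam_eq_Egr, Egr, Egr, ← Real.exp_nat_mul]
  congr 1
  ring

/-- `Egr` composed with the action of an upper-triangular matrix of positive determinant. -/
lemma Egr_smul {g : GL (Fin 2) ℝ} (hg : g 1 0 = 0) (hdet : 0 < g.det.val) (c : ℝ) (τ : ℍ) :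
    Egr c (g • τ) = Egr (c * (g 0 0 / g 1 1)) τ := by
  have h11 : g 1 1 ≠ 0 := by
    intro h
    have := Matrix.det_fin_two g.val
    simp only [hg, h, mul_zero, sub_zero] at this
    exact hdet.ne' (by simpa using this)
  unfold Egr
  congr 1
  rw [UpperHalfPlane.im_smul_eq_div_normSq, abs_of_pos hdet]
  have hd : g.det.val = g 0 0 * g 1 1 := by
    have := Matrix.det_fin_two g.val
    simpa [hg] using this
  rw [hd]
  simp only [denom, hg, Complex.ofReal_zero, zero_mul, zero_add, Complex.normSq_ofReal]
  field_simp

/-! ## The imaginary axis -/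

/-- The point `i · max(y, 1)` of the upper half-plane. -/
def axisPath (y : ℝ) : ℍ := ⟨Complex.I * ((max y 1 : ℝ) : ℂ), by simp⟩

/-- The underlying complex number of `axisPath y` is `i · max(y, 1)`. -/
@[simp] lemma coe_axisPath (y : ℝ) : ((axisPath y : ℍ) : ℂ) = Complex.I * ((max y 1 : ℝ) : ℂ) :=
  rfl

/-- The imaginary part of `axisPath y` is `max(y, 1)`. -/
@[simp] lemma axisPath_im (y : ℝ) : (axisPath y).im = max y 1 := by
  rw [← UpperHalfPlane.coe_im, coe_axisPath]
  simp

/-- The real part of `axisPath y` vanishes. -/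
@[simp] lemma axisPath_re (y : ℝ) : (axisPath y).re = 0 := by
  rw [← UpperHalfPlane.coe_re, coe_axisPath]
  simp

/-- The imaginary part of `axisPath y` is at least `1`. -/
lemma one_le_axisPath_im (y : ℝ) : 1 ≤ (axisPath y).im := by
  simp

/-- The imaginary axis tends to `i∞`. -/
lemma tendsto_axisPath : Tendsto axisPath atTop atImInfty := by
  rw [atImInfty, tendsto_comap_iff]
  have : UpperHalfPlane.im ∘ axisPath = fun y ↦ max y 1 := funext fun y ↦ by simp
  rw [this]
  exact tendsto_atTop_atTop.mpr fun b ↦ ⟨b, fun a ha ↦ le_trans ha (le_max_left _ _)⟩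

/-- `Egr` along the imaginary axis. -/
lemma Egr_axisPath (c y : ℝ) : Egr c (axisPath y) = Real.exp (2 * π * c * max y 1) := by
  simp [Egr]

/-! ## Integer matrices as elements of `GL(2, ℝ)` -/

/-- An integer `2 × 2` matrix viewed in `GL(2, ℝ)` (the junk value `1` if its determinant
vanishes). -/
def glOfInt (μ : Matrix (Fin 2) (Fin 2) ℤ) : GL (Fin 2) ℝ :=
  if h : (μ.map (Int.cast : ℤ → ℝ)).det ≠ 0 then Matrix.GeneralLinearGroup.mkOfDetNeZero _ h
  else 1

/-- Casting to `ℝ` preserves the non-vanishing of the determinant. -/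
lemma det_map_ne_zero {μ : Matrix (Fin 2) (Fin 2) ℤ} (h : μ.det ≠ 0) :
    (μ.map (Int.cast : ℤ → ℝ)).det ≠ 0 := by
  have : μ.map (Int.cast : ℤ → ℝ) = (Int.castRingHom ℝ).mapMatrix μ := rfl
  rw [this, ← RingHom.map_det]
  simpa using h

/-- The underlying real matrix of `glOfInt μ` is the cast of `μ`. -/
lemma glOfInt_val {μ : Matrix (Fin 2) (Fin 2) ℤ} (h : μ.det ≠ 0) :
    ((glOfInt μ : GL (Fin 2) ℝ) : Matrix (Fin 2) (Fin 2) ℝ) = μ.map (Int.cast : ℤ → ℝ) := by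
  rw [glOfInt, dif_pos (det_map_ne_zero h)]
  rfl

/-- The entries of `glOfInt μ` are the casts of the entries of `μ`. -/
@[simp]
lemma glOfInt_apply {μ : Matrix (Fin 2) (Fin 2) ℤ} (h : μ.det ≠ 0) (i j : Fin 2) :
    (glOfInt μ) i j = (μ i j : ℝ) := by
  rw [glOfInt_val h]
  rfl

/-- The determinant of `glOfInt μ` is the cast of `det μ`. -/
lemma glOfInt_det {μ : Matrix (Fin 2) (Fin 2) ℤ} (h : μ.det ≠ 0) :
    ((glOfInt μ : GL (Fin 2) ℝ) : Matrix (Fin 2) (Fin 2) ℝ).det = (μ.det : ℝ) := by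
  rw [Matrix.det_fin_two, Matrix.det_fin_two]
  simp [glOfInt_apply h]

/-- `glOfInt` is multiplicative (on matrices of nonzero determinant). -/
lemma glOfInt_mul {μ ν : Matrix (Fin 2) (Fin 2) ℤ} (hμ : μ.det ≠ 0) (hν : ν.det ≠ 0) :
    glOfInt (μ * ν) = glOfInt μ * glOfInt ν := by
  have hμν : (μ * ν).det ≠ 0 := by
    rw [Matrix.det_mul]; exact mul_ne_zero hμ hν
  ext i j
  simp [Matrix.mul_apply, Fin.sum_univ_two, glOfInt_apply hμ, glOfInt_apply hν, glOfInt_apply hμν]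

/-- On `SL(2, ℤ)`, `glOfInt` is the standard map to `GL(2, ℝ)`. -/
@[simp] lemma glOfInt_coe (γ : SL(2, ℤ)) : glOfInt γ = (γ : GL (Fin 2) ℝ) := by
  ext i j
  simp

/-! ## The matrices `βU` and `βV` -/

/-- The integer matrix `[[1, j], [0, ℓ]]`. -/
def matU (ℓ : ℕ) (j : ℤ) : Matrix (Fin 2) (Fin 2) ℤ := !![1, j; 0, ℓ]

/-- The integer matrix `[[ℓ, 0], [0, 1]]`. -/
def matV (ℓ : ℕ) : Matrix (Fin 2) (Fin 2) ℤ := !![ℓ, 0; 0, 1]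

/-- Entry `(0,0)` of `matU ℓ j` is `1`. -/
@[simp] lemma matU_apply_00 (ℓ : ℕ) (j : ℤ) : matU ℓ j 0 0 = 1 := rfl
/-- Entry `(0,1)` of `matU ℓ j` is `j`. -/
@[simp] lemma matU_apply_01 (ℓ : ℕ) (j : ℤ) : matU ℓ j 0 1 = j := rfl
/-- Entry `(1,0)` of `matU ℓ j` is `0`. -/
@[simp] lemma matU_apply_10 (ℓ : ℕ) (j : ℤ) : matU ℓ j 1 0 = 0 := rfl
/-- Entry `(1,1)` of `matU ℓ j` is `ℓ`. -/
@[simp] lemma matU_apply_11 (ℓ : ℕ) (j : ℤ) : matU ℓ j 1 1 = ℓ := rfl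
/-- Entry `(0,0)` of `matV ℓ` is `ℓ`. -/
@[simp] lemma matV_apply_00 (ℓ : ℕ) : matV ℓ 0 0 = ℓ := rfl
/-- Entry `(0,1)` of `matV ℓ` is `0`. -/
@[simp] lemma matV_apply_01 (ℓ : ℕ) : matV ℓ 0 1 = 0 := rfl
/-- Entry `(1,0)` of `matV ℓ` is `0`. -/
@[simp] lemma matV_apply_10 (ℓ : ℕ) : matV ℓ 1 0 = 0 := rfl
/-- Entry `(1,1)` of `matV ℓ` is `1`. -/
@[simp] lemma matV_apply_11 (ℓ : ℕ) : matV ℓ 1 1 = 1 := rfl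

/-- `det (matU ℓ j) = ℓ`. -/
@[simp] lemma det_matU (ℓ : ℕ) (j : ℤ) : (matU ℓ j).det = ℓ := by
  simp [matU, Matrix.det_fin_two_of]

/-- `det (matV ℓ) = ℓ`. -/
@[simp] lemma det_matV (ℓ : ℕ) : (matV ℓ).det = ℓ := by
  simp [matV, Matrix.det_fin_two_of]

/-- `βU ℓ j = [[1, j], [0, ℓ]]` in `GL(2, ℝ)`. -/
def βU (ℓ : ℕ) (j : ℤ) : GL (Fin 2) ℝ := glOfInt (matU ℓ j)

/-- `βV ℓ = [[ℓ, 0], [0, 1]]` in `GL(2, ℝ)`. -/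
def βV (ℓ : ℕ) : GL (Fin 2) ℝ := glOfInt (matV ℓ)

/-- `βU` unfolds to `glOfInt (matU ℓ j)`. -/
lemma βU_def (ℓ : ℕ) (j : ℤ) : βU ℓ j = glOfInt (matU ℓ j) := rfl

/-- `βV` unfolds to `glOfInt (matV ℓ)`. -/
lemma βV_def (ℓ : ℕ) : βV ℓ = glOfInt (matV ℓ) := rfl

section beta

variable {ℓ : ℕ} [NeZero ℓ]

/-- `det (matU ℓ j) ≠ 0` for `ℓ ≠ 0`. -/
lemma det_matU_ne_zero (j : ℤ) : (matU ℓ j).det ≠ 0 := by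
  simpa using NeZero.ne ℓ

variable (ℓ) in
/-- `det (matV ℓ) ≠ 0` for `ℓ ≠ 0`. -/
lemma det_matV_ne_zero : (matV ℓ).det ≠ 0 := by
  simpa using NeZero.ne ℓ

/-- Entry `(0,0)` of `βU ℓ j` is `1`. -/
@[simp] lemma βU_apply_00 (j : ℤ) : (βU ℓ j) 0 0 = 1 := by
  simp [βU, glOfInt_apply (det_matU_ne_zero j)]
/-- Entry `(0,1)` of `βU ℓ j` is `j`. -/
@[simp] lemma βU_apply_01 (j : ℤ) : (βU ℓ j) 0 1 = j := by
  simp [βU, glOfInt_apply (det_matU_ne_zero j)]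
/-- Entry `(1,0)` of `βU ℓ j` is `0`. -/
@[simp] lemma βU_apply_10 (j : ℤ) : (βU ℓ j) 1 0 = 0 := by
  simp [βU, glOfInt_apply (det_matU_ne_zero j)]
/-- Entry `(1,1)` of `βU ℓ j` is `ℓ`. -/
@[simp] lemma βU_apply_11 (j : ℤ) : (βU ℓ j) 1 1 = ℓ := by
  simp [βU, glOfInt_apply (det_matU_ne_zero j)]
/-- Entry `(0,0)` of `βV ℓ` is `ℓ`. -/
@[simp] lemma βV_apply_00 : (βV ℓ) 0 0 = ℓ := by
  simp [βV, glOfInt_apply (det_matV_ne_zero ℓ)]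
/-- Entry `(0,1)` of `βV ℓ` is `0`. -/
@[simp] lemma βV_apply_01 : (βV ℓ) 0 1 = 0 := by
  simp [βV, glOfInt_apply (det_matV_ne_zero ℓ)]
/-- Entry `(1,0)` of `βV ℓ` is `0`. -/
@[simp] lemma βV_apply_10 : (βV ℓ) 1 0 = 0 := by
  simp [βV, glOfInt_apply (det_matV_ne_zero ℓ)]
/-- Entry `(1,1)` of `βV ℓ` is `1`. -/
@[simp] lemma βV_apply_11 : (βV ℓ) 1 1 = 1 := by
  simp [βV, glOfInt_apply (det_matV_ne_zero ℓ)]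

/-- `det (βU ℓ j) = ℓ`. -/
@[simp] lemma βU_det (j : ℤ) : (βU ℓ j).det.val = ℓ := by
  simp [Matrix.det_fin_two]

variable (ℓ) in
/-- `det (βV ℓ) = ℓ`. -/
@[simp] lemma βV_det : (βV ℓ).det.val = ℓ := by
  simp [Matrix.det_fin_two]

variable (ℓ) in
/-- `(ℓ : ℝ) > 0` for `ℓ ≠ 0`. -/
lemma ℓ_cast_pos : (0 : ℝ) < ℓ := by exact_mod_cast Nat.pos_of_ne_zero (NeZero.ne ℓ)

/-- `det (βU ℓ j) > 0`. -/
lemma βU_det_pos (j : ℤ) : 0 < (βU ℓ j).det.val := by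
  rw [βU_det]; exact ℓ_cast_pos ℓ

variable (ℓ) in
/-- `det (βV ℓ) > 0`. -/
lemma βV_det_pos : 0 < (βV ℓ).det.val := by
  rw [βV_det]; exact ℓ_cast_pos ℓ

/-- The automorphy factor of `βU ℓ j` is the constant `ℓ`. -/
@[simp] lemma denom_βU (j : ℤ) (τ : ℍ) : denom (βU ℓ j) τ = ℓ := by
  simp [denom]

/-- The automorphy factor of `βV ℓ` is the constant `1`. -/
@[simp] lemma denom_βV (τ : ℍ) : denom (βV ℓ) τ = 1 := by
  simp [denom]

/-- The point `βU ℓ j • τ = (τ + j) / ℓ`. -/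
lemma coe_βU_smul (j : ℤ) (τ : ℍ) : ((βU ℓ j • τ : ℍ) : ℂ) = ((τ : ℂ) + j) / ℓ := by
  rw [coe_smul_of_det_pos (βU_det_pos j)]
  simp [num, denom]

/-- The point `βV ℓ • τ = ℓ τ`. -/
lemma coe_βV_smul (τ : ℍ) : ((βV ℓ • τ : ℍ) : ℂ) = ℓ * (τ : ℂ) := by
  rw [coe_smul_of_det_pos (βV_det_pos ℓ)]
  simp [num, denom]

/-- `Im (βU ℓ j • τ) = Im τ / ℓ`. -/
lemma im_βU_smul (j : ℤ) (τ : ℍ) : (βU ℓ j • τ).im = τ.im / ℓ := by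
  rw [← UpperHalfPlane.coe_im, coe_βU_smul]
  simp [Complex.div_natCast_im]

/-- `Im (βV ℓ • τ) = ℓ Im τ`. -/
lemma im_βV_smul (τ : ℍ) : (βV ℓ • τ).im = ℓ * τ.im := by
  rw [← UpperHalfPlane.coe_im, coe_βV_smul]
  simp

/-- Slash action of `βU`: `(f ∣[k] βU ℓ j) τ = f (βU ℓ j • τ) / ℓ`. -/
lemma slash_βU_apply (f : ℍ → ℂ) (k : ℤ) (j : ℤ) (τ : ℍ) :
    (f ∣[k] βU ℓ j) τ = f (βU ℓ j • τ) / ℓ := by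
  rw [ModularForm.slash_apply, σ, if_pos (βU_det_pos j), βU_det, denom_βU]
  have hℓ' : (ℓ : ℂ) ≠ 0 := by exact_mod_cast NeZero.ne ℓ
  rw [abs_of_pos (ℓ_cast_pos ℓ), ContinuousAlgEquiv.refl_apply, Complex.ofReal_natCast,
    mul_assoc, ← zpow_add₀ hℓ', show k - 1 + -k = -1 by ring, _root_.zpow_neg_one, div_eq_mul_inv]

/-- Slash action of `βV`: `(f ∣[k] βV ℓ) τ = ℓ ^ (k - 1) * f (βV ℓ • τ)`. -/
lemma slash_βV_apply (f : ℍ → ℂ) (k : ℤ) (τ : ℍ) :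
    (f ∣[k] βV ℓ) τ = (ℓ : ℂ) ^ (k - 1) * f (βV ℓ • τ) := by
  rw [ModularForm.slash_apply, σ, if_pos (βV_det_pos ℓ), βV_det, denom_βV]
  rw [abs_of_pos (ℓ_cast_pos ℓ), ContinuousAlgEquiv.refl_apply, Complex.ofReal_natCast,
    _root_.one_zpow, mul_one, mul_comm]

/-- The Möbius actions of `βU` and `βV` tend to `i∞` along `i∞`. -/
lemma tendsto_βU_smul (j : ℤ) : Tendsto (fun τ : ℍ ↦ βU ℓ j • τ) atImInfty atImInfty :=
  tendsto_smul_atImInfty (βU_apply_10 j)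

variable (ℓ) in
/-- The Möbius action of `βV` tends to `i∞` along `i∞`. -/
lemma tendsto_βV_smul : Tendsto (fun τ : ℍ ↦ βV ℓ • τ) atImInfty atImInfty :=
  tendsto_smul_atImInfty βV_apply_10

/-- `Egr c (βU ℓ j • τ) = Egr (c / ℓ) τ`. -/
lemma Egr_βU_smul (c : ℝ) (j : ℤ) (τ : ℍ) : Egr c (βU ℓ j • τ) = Egr (c / ℓ) τ := by
  rw [Egr, Egr, im_βU_smul]
  ring_nf

/-- `Egr c (βV ℓ • τ) = Egr (c * ℓ) τ`. -/
lemma Egr_βV_smul (c : ℝ) (τ : ℍ) : Egr c (βV ℓ • τ) = Egr (c * ℓ) τ := by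
  rw [Egr, Egr, im_βV_smul]
  ring_nf

end beta

/-- Transport of an integer matrix identity `μ = γ · matU ℓ j` to `GL(2, ℝ)`. -/
lemma glOfInt_eq_coe_mul_βU {ℓ : ℕ} [NeZero ℓ] {μ : Matrix (Fin 2) (Fin 2) ℤ} {γ : SL(2, ℤ)}
    {j : ℤ} (h : μ = (γ : Matrix (Fin 2) (Fin 2) ℤ) * matU ℓ j) :
    glOfInt μ = (γ : GL (Fin 2) ℝ) * βU ℓ j := by
  rw [h, glOfInt_mul (by simp) (det_matU_ne_zero j), glOfInt_coe, βU_def]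

/-- Transport of an integer matrix identity `μ = γ · matV ℓ` to `GL(2, ℝ)`. -/
lemma glOfInt_eq_coe_mul_βV {ℓ : ℕ} [NeZero ℓ] {μ : Matrix (Fin 2) (Fin 2) ℤ} {γ : SL(2, ℤ)}
    (h : μ = (γ : Matrix (Fin 2) (Fin 2) ℤ) * matV ℓ) :
    glOfInt μ = (γ : GL (Fin 2) ℝ) * βV ℓ := by
  rw [h, glOfInt_mul (by simp) (det_matV_ne_zero ℓ), glOfInt_coe, βV_def]

/-- `βU ℓ j · γ = glOfInt (matU ℓ j · γ)` for `γ ∈ SL(2, ℤ)`. -/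
lemma βU_mul_coe {ℓ : ℕ} [NeZero ℓ] (j : ℤ) (γ : SL(2, ℤ)) :
    βU ℓ j * (γ : GL (Fin 2) ℝ) = glOfInt (matU ℓ j * (γ : Matrix (Fin 2) (Fin 2) ℤ)) := by
  rw [glOfInt_mul (det_matU_ne_zero j) (by simp), glOfInt_coe, βU_def]

/-- `βV ℓ · γ = glOfInt (matV ℓ · γ)` for `γ ∈ SL(2, ℤ)`. -/
lemma βV_mul_coe {ℓ : ℕ} [NeZero ℓ] (γ : SL(2, ℤ)) :
    βV ℓ * (γ : GL (Fin 2) ℝ) = glOfInt (matV ℓ * (γ : Matrix (Fin 2) (Fin 2) ℤ)) := by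
  rw [glOfInt_mul (det_matV_ne_zero ℓ) (by simp), glOfInt_coe, βV_def]

end Summit.Langlands.Langlands.Theorems.CapacityClassicality
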